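/-
Copyright (c) 2026. All rights reserved.
Released under Apache 2.0 license as described in the file LICENSE.
-/
import Literature.Geometry.Kaehler.ComplexTorusQuaternionLangOrderInMaximalOrder
import HarnessLib

/-!
# The two elliptic points of order three of the Shimura curve `X₆` seen on Lang's `(−1,3)` curve: `P₄ = τ₃ = (√3 − 1)(1 + i)/2`
# (the `Z(3)`-point of `3i + j + ij`) and `P₂ = (−1 + i)/(1 + √3)` (of `3i − j + ij`) are fixed by the order-three elements
# `u₄ = (1 + 3i + j + ij)/2 ∈ Γσ²`, `u₂ = (1 + 3i − j + ij)/2 ∈ Γσ` of `Γ₆ = ρ(O₆¹)`, not by `ℝ^×Γ`; `στ₃ ≅_ρ τ₃`;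
# `P₂ ≢ P₄` modulo `Γ` (a norm-`−1` conjugation) and modulo `Γ₆` (Bayer–Travesa 2007, §1 Thm. 1.1, Table 1)

[tag: complex_torus] [tag: abelian_surface] [tag: quaternion_multiplication] [tag: complex_multiplication]
[tag: shimura_curve] [tag: special_cycles] [tag: elliptic_points] [tag: maximal_order]

Lane `lit-hodgefound`, seat p12, row g30-#5 — THEOREMS ONLY (no definition, no named fact, no instance); the sequel of
g30-#3 (`σ = ρ(β)`, `β = 3 + i + j − ij`), g30-#4 (`O₆ = 𝔬 ∪ (e + 𝔬)`, `e = (1 + i + j − ij)/2`, `β = 2e²`,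
`O₆ = 𝔬 ⊔ 𝔬e² ⊔ 𝔬e⁴`, `Γ₆ = Γ ⊔ Γσ ⊔ Γσ²`, `exists_order_unit_moebius_eq`) and g28-#3 (`…NormThreeCMPoint`: `τ₃`, the
fixed point of `ρ(3i + j + ij)`, `A(τ₃) ≅ ℂ/ℤ[ω] × ℂ/ℤ[√−3]`, `w(A(τ₃), ι) = 2` — `τ₃` is NOT an elliptic point of Lang's
`Γ = ρ(𝔬¹)`, whose elliptic elements all have order `2` since traces in `ρ(ℤ⟨1, i, j, ij⟩)` are even). Dictionary with
Bayer–Travesa (g30-#4): `I = j`, `J = −i`, `K = ij`, `Φ = ρ`, `Γ₆ = ρ(O₆¹)`, `O₆ ∋ u ⟺ u ∈ 𝔬 ∨ u − e ∈ 𝔬`.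

## The print, VERBATIM

* P. Bayer, A. Travesa (2007) [BayerTravesa2007] §1 Thm. 1.1 p. 317: «The vertices `P₁ ≡ P₃ ≡ P₅ (mod Γ₆)` and `P₆` are
  elliptic of order `2`; the remaining vertices `P₂, P₄` are elliptic of order `3`» (vertices of a fundamental hexagon of
  `Γ₆` with the identifications (a) `η₂[P₃, P₂] = [P₁, P₂]`, (b) `η₄[P₃, P₄] = [P₅, P₄]`, (c) `η₆[P₅, P₆] = [P₁, P₆]`);
  Table 1 p. 318: `P₂ = (−1 + i)/(1 + √3)`, `P₄ = (1 + i)/(1 + √3)`.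
* S. Kudla, M. Rapoport, T. Yang (2006) [KudlaRapoportYang2006] §3.2 Prop. 3.2.1; §3.4 (3.4.8)–(3.4.9), Lemma 3.4.3,
  (3.4.13).
* T. Shioda, N. Mitani (1974) [ShiodaMitani1974] §4 Thm. 4.1 (iii). S. Lang (1982) [Lang1982AbelianFunctions] IX §4–§5.

`(1 + i)/(1 + √3) = (√3 − 1)(1 + i)/2 = τ₃` and `(−1 + i)/(1 + √3) = ((1 − √3) + (√3 − 1)i)/2 =: P₂`.

## What is proved (`x = 3i + j + ij`, `x′ = 3i − j + ij`, `u₄ = (1 + x)/2`, `u₂ = (1 + x′)/2`, `e = (1 + i + j − ij)/2`)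

* §1 `Q(x′) = 3`, `x′ ∈ 𝔬`, `Im P₂ > 0`, `ρ(x′) = (−√3, √3 − 3; 3 + √3, √3)`, **`ρ(x′)P₂ = P₂`** (`P₂ ∈ D_{x′}`, a `Z(3)`-point);
  **`A(P₂) ≅ ℂ/ℤ[ω] × ℂ/ℤ[√−3] ≅ A(τ₃)`** as complex tori (g30-#1's `Z(3)` identification).
* §2 **`u₄ − e = i + ij ∈ 𝔬` (`u₄ ∈ O₆`), `u₄ū₄ = 1`, `u₄² = u₄ − 1`, `u₄³ = −1`**; the same for `u₂` (`u₂ − e = i − j + ij`);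
  the cosets **`u₄ = (4 − 2j + ij)e²e²`, `u₂ = (3 + 2i − 2j)e²` with `4 − 2j + ij, 3 + 2i − 2j ∈ 𝔬¹`**; the general
  **`ρ(q + x)τ = τ` whenever `ρ(x)τ = τ`** (`x` special, `q ∈ ℚ`, `τ ∉ ℝ`: the eigenvalue `λ` of `ρ(x)` on `(τ, 1)ᵗ` has
  `λ² = −nr x < 0`, so `q + λ ≠ 0`) — `moebius_rho_coe_add_fixed`; hence **`ρ(u₄)τ₃ = τ₃` and `ρ(u₂)P₂ = P₂`**; and
  **`ρ(u₄) ∉ ℝ^×ρ(𝔬^×)`** (`u₄ = cε` forces `ε = ε₀(1, 3, 1, 1)`, `nr ε = 4ε₀²`).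
* §3 **`στ₃ ≅_ρ τ₃`** (`Ad(β)x = 3i − j − ij = īxī⁻¹…`: the unit `i` conjugates it back to `x`) — `σ` fixes the `Γ`-class of `τ₃`;
  **`(A(τ₃), ρ) ≇ (A(P₂), ρ)`** (the norm-`−1` unit `1 − i − ij` conjugates `x` to `x′`: KRY Lemma 3.4.3, g29-#6's obstruction);
  **no `u ∈ O₆` with `uū = 1` maps `τ₃` to `P₂`** (`P₂ ≢ P₄ (mod Γ₆)`, via `Γ₆ = Γ ⊔ Γσ ⊔ Γσ²`); summary theorem.

## Honest scope

Only the two points `P₂`, `P₄` of Table 1 and the elements `u₂`, `u₄`; no claim that they are the ONLY elliptic points of order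
`3` of `X₆` (Bayer–Travesa's `e₃ = 2` is not re-derived), no fundamental domain, no isotropy-group computation beyond exhibiting
one element of order `3` (`u³ = −1`) outside `ℝ^×Γ`; the stabiliser of `τ₃` in `Γ` being `±1` is g28-#3's `natCard_units_tauThree`
(cited, not restated). 0 definitions, 0 named facts, 0 instances — net debt `0`.

## References
* [BayerTravesa2007] P. Bayer, A. Travesa, *Uniformizing functions for certain Shimura curves, in the case D = 6*, Acta
  Arith. 126 (2007), 315–339, §1 Thm. 1.1, Table 1.
* [KudlaRapoportYang2006] S. Kudla, M. Rapoport, T. Yang, *Modular Forms and Special Cycles on Shimura Curves* (2006), §3.2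
  Prop. 3.2.1, §3.4 (3.4.8)–(3.4.9), Lemma 3.4.3, (3.4.13).
* [ShiodaMitani1974] T. Shioda, N. Mitani, *Singular abelian surfaces and binary quadratic forms* (1974), §4 Thm. 4.1 (iii).
* [Lang1982AbelianFunctions] S. Lang, *Introduction to Algebraic and Abelian Functions*, 2nd ed. (1982), Ch. IX §4–§5.
-/

noncomputable section

set_option maxSynthPendingDepth 3

open Complex Module Matrix Quaternion Function
open scoped ComplexConjugate

namespace Literature.Geometry.Kaehler.ComplexTorus.QuaternionType

section SqrtThreeAux

/-- `√3·√3 = 3`. [folklore] -/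
private theorem sqrt_three_mul_self' : Real.sqrt 3 * Real.sqrt 3 = 3 := Real.mul_self_sqrt (by norm_num)

/-- `1 < √3`. [folklore] -/
private theorem one_lt_sqrt_three' : 1 < Real.sqrt 3 := by
  rw [show (1 : ℝ) = Real.sqrt 1 by simp]
  exact Real.sqrt_lt_sqrt (by norm_num) (by norm_num)

/-- `M(τ) = τ` from the cleared-denominator identity. [folklore] -/
private theorem moebius_eq_self_of' {N : Matrix (Fin 2) (Fin 2) ℝ} {τ : ℂ} (hden : (N 1 0 : ℂ) * τ + N 1 1 ≠ 0)
    (h : (N 0 0 : ℂ) * τ + N 0 1 = τ * ((N 1 0 : ℂ) * τ + N 1 1)) : moebius N τ = τ := by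
  rw [moebius_apply, div_eq_iff hden, h]

end SqrtThreeAux

/-! ## §1 `P₂ = (−1 + i)/(1 + √3) = (1 − √3)(1 − i)/2·(−1)`: the CM point of `x′ = 3i − j + ij ∈ L(3)` -/

section PTwo

/-- `Q(3i − j + ij) = 9 − 3 − 3 = 3`: `x′ ∈ L(3)`. [cite: KudlaRapoportYang2006, §3.4 (3.4.8)] -/
theorem norm_three_i_sub_j_add_ij :
    ((⟨0, 3, -1, 1⟩ : ℍ[ℚ,((-1 : ℤ) : ℚ),((3 : ℤ) : ℚ)]) * star ⟨0, 3, -1, 1⟩).re = 3 := by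
  rw [QuaternionAlgebra.star_mk, QuaternionAlgebra.mk_mul_mk]
  norm_num

/-- `3i − j + ij ∈ 𝔬`. [cite: Lang1982AbelianFunctions, Ch. IX §4] -/
theorem three_i_sub_j_add_ij_mem_order : (⟨0, 3, -1, 1⟩ : ℍ[ℚ,((-1 : ℤ) : ℚ),((3 : ℤ) : ℚ)]) ∈ order (-1) 3 :=
  ⟨![0, 3, -1, 1], by ext <;> simp [ofCoords]⟩

/-- `0 < Im P₂ = (√3 − 1)/2`. [cite: BayerTravesa2007, §1 Table 1 (`P₂ = (−1 + i)/(1 + √3)`)] -/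
theorem tauThreeBis_im_pos : 0 < (⟨(1 - Real.sqrt 3) / 2, (Real.sqrt 3 - 1) / 2⟩ : ℂ).im := by
  show 0 < (Real.sqrt 3 - 1) / 2
  have := one_lt_sqrt_three'
  linarith

/-- **`ρ(3i − j + ij) = (−√3, √3 − 3; 3 + √3, √3)`.** [cite: Lang1982AbelianFunctions, Ch. IX §4] -/
theorem rho_three_i_sub_j_add_ij :
    rho (-1) 3 (by norm_num) (castQ (-1) 3 (⟨0, 3, -1, 1⟩ : ℍ[ℚ,((-1 : ℤ) : ℚ),((3 : ℤ) : ℚ)])) =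
      !![-Real.sqrt 3, Real.sqrt 3 - 3; 3 + Real.sqrt 3, Real.sqrt 3] := by
  rw [rho_apply]
  ext i j
  fin_cases i <;> fin_cases j <;> norm_num [castQ]
  ring

/-- **`P₂ = (1 − √3)/2 + i(√3 − 1)/2 = (−1 + i)/(1 + √3)` IS FIXED BY `ρ(3i − j + ij)`** (denominator `(3 + √3)P₂ + √3 = i√3`):
the CM point of `x′ = 3i − j + ij ∈ L(3)`, Bayer–Travesa's vertex `P₂`. [cite: BayerTravesa2007, §1 Table 1 (`P₂`)] [cite: KudlaRapoportYang2006, §3.4 (3.4.9)] -/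
theorem moebius_rho_tauThreeBis :
    moebius (rho (-1) 3 (by norm_num) (castQ (-1) 3 (⟨0, 3, -1, 1⟩ : ℍ[ℚ,((-1 : ℤ) : ℚ),((3 : ℤ) : ℚ)])))
        ⟨(1 - Real.sqrt 3) / 2, (Real.sqrt 3 - 1) / 2⟩ = ⟨(1 - Real.sqrt 3) / 2, (Real.sqrt 3 - 1) / 2⟩ := by
  have hs := sqrt_three_mul_self'
  rw [rho_three_i_sub_j_add_ij]
  have hden : ((!![-Real.sqrt 3, Real.sqrt 3 - 3; 3 + Real.sqrt 3, Real.sqrt 3] 1 0 : ℝ) : ℂ) *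
        ⟨(1 - Real.sqrt 3) / 2, (Real.sqrt 3 - 1) / 2⟩ +
      ((!![-Real.sqrt 3, Real.sqrt 3 - 3; 3 + Real.sqrt 3, Real.sqrt 3] 1 1 : ℝ) : ℂ) = ⟨0, Real.sqrt 3⟩ := by
    apply Complex.ext
    · simp
      nlinarith [hs]
    · simp
      nlinarith [hs]
  have hs0 : Real.sqrt 3 ≠ 0 := by have := one_lt_sqrt_three'; positivity
  refine moebius_eq_self_of' (by rw [hden]; exact fun h ↦ hs0 (by simpa using congrArg Complex.im h)) ?_
  rw [hden]
  apply Complex.ext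
  · simp
    nlinarith [hs]
  · simp
    nlinarith [hs]

/-- **`A(P₂) ≅ ℂ/ℤ[ω] × ℂ/ℤ[√−3] ≅ A(P₄)`** as complex tori (g30-#1's `Z(3)` identification at both points): one abelian
surface under the two order-`3` elliptic points of `X₆`. [cite: ShiodaMitani1974, §4 Thm. 4.1 (iii)] [cite: KudlaRapoportYang2006, §3.4 (3.4.8)–(3.4.9), (3.4.13)] -/
theorem isIsomorphic_period_tauThreeBis_prod_and :
    IsIsomorphic (period (-1) 3 (by norm_num) (by norm_num) tauThreeBis_im_pos.ne')
        (prodPeriod (ellipticPeriod omega_im_ne_zero) (ellipticPeriod (sqrt_mul_I_im_ne_zero (t := 3) (by norm_num)))) ∧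
    IsIsomorphic (period (-1) 3 (by norm_num) (by norm_num) tauThreeBis_im_pos.ne')
        (period (-1) 3 (by norm_num) (by norm_num) tauThree_im_pos.ne') := by
  have h₂ := isIsomorphic_prod_omega_sqrtThree_of_moebius_eq tauThreeBis_im_pos (p := ![3, -1, 1]) (by norm_num [Matrix.cons_val_two, Matrix.tail_cons])
    (x := ⟨0, 3, -1, 1⟩) (by ext <;> simp) moebius_rho_tauThreeBis
  have h₄ := isIsomorphic_prod_omega_sqrtThree_of_moebius_eq tauThree_im_pos (p := ![3, 1, 1]) (by norm_num [Matrix.cons_val_two, Matrix.tail_cons])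
    (x := ⟨0, 3, 1, 1⟩) (by ext <;> simp) moebius_rho_tauThree
  exact ⟨h₂, h₂.trans h₄.symm⟩

end PTwo

/-! ## §2 The order-three elements `u₄ = (1 + 3i + j + ij)/2`, `u₂ = (1 + 3i − j + ij)/2` of `O₆¹` fixing `P₄ = τ₃`, `P₂` -/

section OrderThree

/-- **`u₄ = (1 + x)/2 ∈ O₆`** (`u₄ − e = i + ij ∈ 𝔬`), **`u₄ū₄ = 1`, `u₄² = u₄ − 1`, `u₄³ = −1`**: an element of order `6` in `O₆¹`,
of order `3` in `Γ₆/±1`. [cite: BayerTravesa2007, §1 Thm. 1.1 («`P₂, P₄` are elliptic of order `3`»)] -/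
theorem uFour_mem_and :
    (⟨1/2, 3/2, 1/2, 1/2⟩ : ℍ[ℚ,((-1 : ℤ) : ℚ),((3 : ℤ) : ℚ)]) - ⟨1/2, 1/2, 1/2, -1/2⟩ ∈ order (-1) 3 ∧
    (⟨1/2, 3/2, 1/2, 1/2⟩ : ℍ[ℚ,((-1 : ℤ) : ℚ),((3 : ℤ) : ℚ)]) * star ⟨1/2, 3/2, 1/2, 1/2⟩ = 1 ∧
    (⟨1/2, 3/2, 1/2, 1/2⟩ : ℍ[ℚ,((-1 : ℤ) : ℚ),((3 : ℤ) : ℚ)]) * ⟨1/2, 3/2, 1/2, 1/2⟩ = ⟨1/2, 3/2, 1/2, 1/2⟩ - 1 ∧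
    (⟨1/2, 3/2, 1/2, 1/2⟩ : ℍ[ℚ,((-1 : ℤ) : ℚ),((3 : ℤ) : ℚ)]) * ⟨1/2, 3/2, 1/2, 1/2⟩ * ⟨1/2, 3/2, 1/2, 1/2⟩ = -1 := by
  refine ⟨⟨![0, 1, 0, 1], by rw [QuaternionAlgebra.mk_sub_mk]; ext <;> simp [ofCoords] <;> norm_num⟩, ?_, ?_, ?_⟩
  · rw [QuaternionAlgebra.star_mk, QuaternionAlgebra.mk_mul_mk]; ext <;> norm_num
  · rw [QuaternionAlgebra.mk_mul_mk]; ext <;> norm_num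
  · rw [QuaternionAlgebra.mk_mul_mk, QuaternionAlgebra.mk_mul_mk]; ext <;> norm_num

/-- **`u₂ = (1 + x′)/2 ∈ O₆`** (`u₂ − e = i − j + ij`), `u₂ū₂ = 1`, `u₂² = u₂ − 1`, `u₂³ = −1`. [cite: BayerTravesa2007, §1 Thm. 1.1] -/
theorem uTwo_mem_and :
    (⟨1/2, 3/2, -1/2, 1/2⟩ : ℍ[ℚ,((-1 : ℤ) : ℚ),((3 : ℤ) : ℚ)]) - ⟨1/2, 1/2, 1/2, -1/2⟩ ∈ order (-1) 3 ∧
    (⟨1/2, 3/2, -1/2, 1/2⟩ : ℍ[ℚ,((-1 : ℤ) : ℚ),((3 : ℤ) : ℚ)]) * star ⟨1/2, 3/2, -1/2, 1/2⟩ = 1 ∧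
    (⟨1/2, 3/2, -1/2, 1/2⟩ : ℍ[ℚ,((-1 : ℤ) : ℚ),((3 : ℤ) : ℚ)]) * ⟨1/2, 3/2, -1/2, 1/2⟩ = ⟨1/2, 3/2, -1/2, 1/2⟩ - 1 ∧
    (⟨1/2, 3/2, -1/2, 1/2⟩ : ℍ[ℚ,((-1 : ℤ) : ℚ),((3 : ℤ) : ℚ)]) * ⟨1/2, 3/2, -1/2, 1/2⟩ * ⟨1/2, 3/2, -1/2, 1/2⟩ = -1 := by
  refine ⟨⟨![0, 1, -1, 1], by rw [QuaternionAlgebra.mk_sub_mk]; ext <;> simp [ofCoords] <;> norm_num⟩, ?_, ?_, ?_⟩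
  · rw [QuaternionAlgebra.star_mk, QuaternionAlgebra.mk_mul_mk]; ext <;> norm_num
  · rw [QuaternionAlgebra.mk_mul_mk]; ext <;> norm_num
  · rw [QuaternionAlgebra.mk_mul_mk, QuaternionAlgebra.mk_mul_mk]; ext <;> norm_num

/-- **The cosets: `u₄ = (4 − 2j + ij)·e²·e² ∈ 𝔬¹e⁴` and `u₂ = (3 + 2i − 2j)·e² ∈ 𝔬¹e²`** (`4 − 2j + ij`, `3 + 2i − 2j ∈ 𝔬¹`):
`ρ(u₄) ∈ Γσ²`, `ρ(u₂) ∈ Γσ`. [cite: BayerTravesa2007, §1] [cite: Ogg1983RealPoints, §2 p. 283] -/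
theorem uFour_uTwo_cosets :
    (⟨1/2, 3/2, 1/2, 1/2⟩ : ℍ[ℚ,((-1 : ℤ) : ℚ),((3 : ℤ) : ℚ)]) =
      ⟨4, 0, -2, 1⟩ * ((⟨1/2, 1/2, 1/2, -1/2⟩ : ℍ[ℚ,((-1 : ℤ) : ℚ),((3 : ℤ) : ℚ)]) * ⟨1/2, 1/2, 1/2, -1/2⟩) *
        ((⟨1/2, 1/2, 1/2, -1/2⟩ : ℍ[ℚ,((-1 : ℤ) : ℚ),((3 : ℤ) : ℚ)]) * ⟨1/2, 1/2, 1/2, -1/2⟩) ∧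
    (⟨1/2, 3/2, -1/2, 1/2⟩ : ℍ[ℚ,((-1 : ℤ) : ℚ),((3 : ℤ) : ℚ)]) =
      ⟨3, 2, -2, 0⟩ * ((⟨1/2, 1/2, 1/2, -1/2⟩ : ℍ[ℚ,((-1 : ℤ) : ℚ),((3 : ℤ) : ℚ)]) * ⟨1/2, 1/2, 1/2, -1/2⟩) ∧
    ((⟨4, 0, -2, 1⟩ : ℍ[ℚ,((-1 : ℤ) : ℚ),((3 : ℤ) : ℚ)]) ∈ order (-1) 3 ∧
      (⟨4, 0, -2, 1⟩ : ℍ[ℚ,((-1 : ℤ) : ℚ),((3 : ℤ) : ℚ)]) * star ⟨4, 0, -2, 1⟩ = 1) ∧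
    ((⟨3, 2, -2, 0⟩ : ℍ[ℚ,((-1 : ℤ) : ℚ),((3 : ℤ) : ℚ)]) ∈ order (-1) 3 ∧
      (⟨3, 2, -2, 0⟩ : ℍ[ℚ,((-1 : ℤ) : ℚ),((3 : ℤ) : ℚ)]) * star ⟨3, 2, -2, 0⟩ = 1) := by
  refine ⟨?_, ?_, ⟨⟨![4, 0, -2, 1], by ext <;> simp [ofCoords]⟩, ?_⟩, ⟨⟨![3, 2, -2, 0], by ext <;> simp [ofCoords]⟩, ?_⟩⟩
  · rw [e_sq_eq, QuaternionAlgebra.mk_mul_mk, QuaternionAlgebra.mk_mul_mk]; ext <;> norm_num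
  · rw [e_sq_eq, QuaternionAlgebra.mk_mul_mk]; ext <;> norm_num
  · rw [QuaternionAlgebra.star_mk, QuaternionAlgebra.mk_mul_mk]; ext <;> norm_num
  · rw [QuaternionAlgebra.star_mk, QuaternionAlgebra.mk_mul_mk]; ext <;> norm_num

variable {a b : ℤ}

/-- **`ρ(q + x)` fixes the fixed point of `ρ(x)`** (`x` special, `q ∈ ℚ`): `ρ(x)(τ, 1)ᵗ = λ(τ, 1)ᵗ` with `λ² = −nr x < 0`,
so `ρ(q + x)(τ, 1)ᵗ = (q + λ)(τ, 1)ᵗ` with `q + λ ≠ 0`. [cite: Lang1982AbelianFunctions, Ch. IX §5 (3)] [cite: KudlaRapoportYang2006, §3.4 (3.4.9)] -/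
theorem moebius_rho_coe_add_fixed (hb : 0 < b) {x : ℍ[ℚ,(a : ℚ),(b : ℚ)]} (hx : x.re = 0) (ht : 0 < (x * star x).re)
    (q : ℚ) {τ : ℂ} (hτ : τ.im ≠ 0) (hfix : moebius (rho a b hb.le (castQ a b x)) τ = τ) :
    moebius (rho a b hb.le (castQ a b ((q : ℍ[ℚ,(a : ℚ),(b : ℚ)]) + x))) τ = τ := by
  have hden := rho_denom_ne_zero (a := a) (b := b) (hb := hb) hτ ht.ne'
  set lam : ℂ := (rho a b hb.le (castQ a b x) 1 0 : ℂ) * τ + rho a b hb.le (castQ a b x) 1 1 with hlam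
  have hact : act (rho a b hb.le (castQ a b x)) (uVec τ) = lam • uVec τ :=
    (act_uVec_eq_smul_uVec_iff _ τ τ hden).2 hfix
  -- `x² = −nr x` (as a scalar), hence `λ² = −nr x`
  have hx2 : x * x = ((-(x * star x).re : ℚ) : ℍ[ℚ,(a : ℚ),(b : ℚ)]) := by
    obtain ⟨x₀, x₁, x₂, x₃⟩ := x
    simp only at hx
    subst hx
    rw [QuaternionAlgebra.star_mk, QuaternionAlgebra.mk_mul_mk, QuaternionAlgebra.mk_mul_mk]
    ext <;> simp <;> ring
  have hc : ∀ r : ℚ, castQ a b (r : ℍ[ℚ,(a : ℚ),(b : ℚ)]) = ((r : ℚ) : ℝ) • (1 : ℍ[ℝ,(a : ℝ),(b : ℝ)]) := by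
    intro r; ext <;> simp [castQ]
  have hlam2 : lam * lam = (((-(x * star x).re : ℚ) : ℝ) : ℂ) := by
    have h2 : act (rho a b hb.le (castQ a b x) * rho a b hb.le (castQ a b x)) (uVec τ) = (lam * lam) • uVec τ := by
      rw [act_mul, hact, map_smul, hact, smul_smul]
    rw [← map_mul, ← castQ_mul, hx2, hc, map_smul, map_one, act_smul, _root_.smul_apply, act_one] at h2
    have h1 := congrFun h2 1
    rw [Pi.smul_apply, Pi.smul_apply, uVec_one, smul_eq_mul, smul_eq_mul, mul_one, mul_one] at h1
    exact h1.symm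
  have hql : (((q : ℚ) : ℝ) : ℂ) + lam ≠ 0 := by
    intro h0
    have hl : lam = -(((q : ℚ) : ℝ) : ℂ) := by linear_combination h0
    rw [hl, neg_mul_neg] at hlam2
    have hre : ((q : ℚ) : ℝ) * ((q : ℚ) : ℝ) = ((-(x * star x).re : ℚ) : ℝ) := by exact_mod_cast hlam2
    push_cast at hre
    have : (0 : ℝ) < (x * star x).re := by exact_mod_cast ht
    nlinarith [sq_nonneg ((q : ℚ) : ℝ)]
  -- `ρ(q + x)(τ,1)ᵗ = (q + λ)(τ,1)ᵗ`
  have hact' : act (rho a b hb.le (castQ a b ((q : ℍ[ℚ,(a : ℚ),(b : ℚ)]) + x))) (uVec τ) =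
      ((((q : ℚ) : ℝ) : ℂ) + lam) • uVec τ := by
    rw [castQ_add, map_add, hc, map_smul, map_one, act_add, _root_.add_apply, act_smul, _root_.smul_apply, act_one,
      hact]
    exact (add_smul _ _ _).symm
  exact moebius_eq_of_act_uVec_eq_smul_uVec hact' hql

/-- **`ρ(u₄)τ₃ = τ₃`: `P₄ = τ₃ = (√3 − 1)(1 + i)/2` IS FIXED BY THE ORDER-THREE ELEMENT `ρ(u₄)` OF `Γ₆`** (`u₄ = ½(1 + x)`,
`ρ(x)τ₃ = τ₃` by g28-#3) — whereas in Lang's `Γ` its stabiliser is `±1` (`w(A(τ₃), ι) = 2`, g28-#3 `natCard_units_tauThree`):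
`τ₃` is not an elliptic point of Lang's curve but IS an elliptic point of order `3` of `X₆`. [cite: BayerTravesa2007, §1 Thm. 1.1 («the remaining vertices `P₂, P₄` are elliptic of order `3`») and Table 1 (`P₄ = (1 + i)/(1 + √3)`)] -/
theorem moebius_rho_uFour_tauThree :
    moebius (rho (-1) 3 (by norm_num) (castQ (-1) 3 (⟨1/2, 3/2, 1/2, 1/2⟩ : ℍ[ℚ,((-1 : ℤ) : ℚ),((3 : ℤ) : ℚ)])))
        ⟨(Real.sqrt 3 - 1) / 2, (Real.sqrt 3 - 1) / 2⟩ = ⟨(Real.sqrt 3 - 1) / 2, (Real.sqrt 3 - 1) / 2⟩ := by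
  have h1 := moebius_rho_coe_add_fixed (a := -1) (b := 3) (by norm_num)
    (x := (⟨0, 3, 1, 1⟩ : ℍ[ℚ,((-1 : ℤ) : ℚ),((3 : ℤ) : ℚ)])) rfl (by rw [norm_three_i_add_j_add_ij]; norm_num) 1
    tauThree_im_ne_zero moebius_rho_tauThree
  have hu : (⟨1/2, 3/2, 1/2, 1/2⟩ : ℍ[ℚ,((-1 : ℤ) : ℚ),((3 : ℤ) : ℚ)]) =
      (1/2 : ℚ) • ((((1 : ℚ) : ℍ[ℚ,((-1 : ℤ) : ℚ),((3 : ℤ) : ℚ)])) + ⟨0, 3, 1, 1⟩) := by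
    rw [show (((1 : ℚ) : ℍ[ℚ,((-1 : ℤ) : ℚ),((3 : ℤ) : ℚ)])) = ⟨1, 0, 0, 0⟩ from rfl, QuaternionAlgebra.mk_add_mk,
      QuaternionAlgebra.smul_mk]
    ext <;> norm_num
  rw [hu, castQ_smul, map_smul, moebius_smul_of_ne_zero (by norm_num), h1]

/-- **`ρ(u₂)P₂ = P₂`**: `P₂` is fixed by the order-three element `ρ(u₂) ∈ Γ₆`. [cite: BayerTravesa2007, §1 Thm. 1.1 and Table 1 (`P₂ = (−1 + i)/(1 + √3)`)] -/
theorem moebius_rho_uTwo_tauThreeBis :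
    moebius (rho (-1) 3 (by norm_num) (castQ (-1) 3 (⟨1/2, 3/2, -1/2, 1/2⟩ : ℍ[ℚ,((-1 : ℤ) : ℚ),((3 : ℤ) : ℚ)])))
        ⟨(1 - Real.sqrt 3) / 2, (Real.sqrt 3 - 1) / 2⟩ = ⟨(1 - Real.sqrt 3) / 2, (Real.sqrt 3 - 1) / 2⟩ := by
  have h1 := moebius_rho_coe_add_fixed (a := -1) (b := 3) (by norm_num)
    (x := (⟨0, 3, -1, 1⟩ : ℍ[ℚ,((-1 : ℤ) : ℚ),((3 : ℤ) : ℚ)])) rfl (by rw [norm_three_i_sub_j_add_ij]; norm_num) 1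
    tauThreeBis_im_pos.ne' moebius_rho_tauThreeBis
  have hu : (⟨1/2, 3/2, -1/2, 1/2⟩ : ℍ[ℚ,((-1 : ℤ) : ℚ),((3 : ℤ) : ℚ)]) =
      (1/2 : ℚ) • ((((1 : ℚ) : ℍ[ℚ,((-1 : ℤ) : ℚ),((3 : ℤ) : ℚ)])) + ⟨0, 3, -1, 1⟩) := by
    rw [show (((1 : ℚ) : ℍ[ℚ,((-1 : ℤ) : ℚ),((3 : ℤ) : ℚ)])) = ⟨1, 0, 0, 0⟩ from rfl, QuaternionAlgebra.mk_add_mk,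
      QuaternionAlgebra.smul_mk]
    ext <;> norm_num
  rw [hu, castQ_smul, map_smul, moebius_smul_of_ne_zero (by norm_num), h1]

/-- **`ρ(u₄) ∉ ℝ^×ρ(𝔬^×)`**: the stabilising element is NOT induced by a unit of Lang's order (if `u₄ = cε` then
`ε = ε₀(1, 3, 1, 1)`, `nr ε = 4ε₀² ≠ ±1`). [cite: BayerTravesa2007, §1 Thm. 1.1] [cite: Lang1982AbelianFunctions, Ch. IX §5 Thm. 5.1] -/
theorem rho_uFour_ne_smul_rho_unit (c : ℝ) {ε : ℍ[ℚ,((-1 : ℤ) : ℚ),((3 : ℤ) : ℚ)]} (hε : ε ∈ order (-1) 3)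
    (hunit : ε * star ε = 1 ∨ ε * star ε = -1) :
    rho (-1) 3 (by norm_num) (castQ (-1) 3 (⟨1/2, 3/2, 1/2, 1/2⟩ : ℍ[ℚ,((-1 : ℤ) : ℚ),((3 : ℤ) : ℚ)])) ≠
      c • rho (-1) 3 (by norm_num) (castQ (-1) 3 ε) := by
  intro h
  rw [← map_smul] at h
  have h' := rho_injective (a := -1) (b := 3) (by norm_num) (by norm_num) h
  obtain ⟨m, rfl⟩ := hε
  have h0 := congrArg QuaternionAlgebra.re h'
  have h1 := congrArg QuaternionAlgebra.imI h'
  have h2 := congrArg QuaternionAlgebra.imJ h'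
  have h3 := congrArg QuaternionAlgebra.imK h'
  simp [castQ, ofCoords] at h0 h1 h2 h3
  have hc : c ≠ 0 := by rintro rfl; norm_num at h1
  have hm1 : (m 1 : ℝ) = 3 * m 0 := by
    have : c * (m 1 - 3 * m 0) = 0 := by linear_combination -h1 + 3 * h0
    have := (mul_eq_zero.1 this).resolve_left hc
    linarith
  have hm2 : (m 2 : ℝ) = m 0 := by
    have : c * (m 2 - m 0) = 0 := by linear_combination -h2 + h0
    have := (mul_eq_zero.1 this).resolve_left hc
    linarith
  have hm3 : (m 3 : ℝ) = m 0 := by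
    have : c * (m 3 - m 0) = 0 := by linear_combination -h3 + h0
    have := (mul_eq_zero.1 this).resolve_left hc
    linarith
  have hm1' : m 1 = 3 * m 0 := by exact_mod_cast hm1
  have hm2' : m 2 = m 0 := by exact_mod_cast hm2
  have hm3' : m 3 = m 0 := by exact_mod_cast hm3
  have hn : (ofCoords (-1) 3 (fun k ↦ ((m k : ℤ) : ℚ)) * star (ofCoords (-1) 3 (fun k ↦ ((m k : ℤ) : ℚ)))).re =
      4 * (m 0 : ℚ) ^ 2 := by
    simp only [QuaternionAlgebra.re_mul, QuaternionAlgebra.re_star, QuaternionAlgebra.imI_star, QuaternionAlgebra.imJ_star,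
      QuaternionAlgebra.imK_star, ofCoords_re, ofCoords_imI, ofCoords_imJ, ofCoords_imK, hm1', hm2', hm3']
    push_cast
    ring
  rcases hunit with hu | hu
  · have := congrArg QuaternionAlgebra.re hu
    rw [hn, QuaternionAlgebra.re_one] at this
    have h4 : (4 : ℚ) * (m 0 : ℚ) ^ 2 = 1 := this
    have : (2 * m 0) * (2 * m 0) = (1 : ℤ) := by exact_mod_cast (by linear_combination h4 : (2 * (m 0 : ℚ)) * (2 * m 0) = 1)
    rcases Int.eq_one_or_neg_one_of_mul_eq_one this with h | h <;> omega
  · have := congrArg QuaternionAlgebra.re hu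
    rw [hn, QuaternionAlgebra.re_neg, QuaternionAlgebra.re_one] at this
    have h4 : (4 : ℚ) * (m 0 : ℚ) ^ 2 = -1 := this
    nlinarith [sq_nonneg (m 0 : ℚ)]

end OrderThree

/-! ## §3 `σ` fixes the class of `τ₃`; `P₂` and `P₄` are inequivalent under `Γ` and under `Γ₆` -/

section Classes

/-- **`στ₃ ≅_ρ τ₃`: the order-three symmetry `σ` of g30-#3 FIXES the `Γ`-class of `τ₃`** — `Ad(β)(3i + j + ij) = 3i − j − ij`
and the unit `i` conjugates it back to `3i + j + ij` (this is why `τ₃` acquires a stabiliser of order `3` in `Γ₆ = Γ ⊔ Γσ ⊔ Γσ²`).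
[cite: BayerTravesa2007, §1 Thm. 1.1] [cite: KudlaRapoportYang2006, §3.2 Prop. 3.2.1 and §3.4 (3.4.13)] -/
theorem isRhoIsomorphic_sigma_tauThree_tauThree :
    IsRhoIsomorphic (a := -1) (b := 3) (by norm_num) (by norm_num)
      (im_sigma_coe_pos ⟨_, tauThree_im_pos⟩).ne' tauThree_im_pos.ne' :=
  isRhoIsomorphic_of_conj_norm_one (a := -1) (b := 3) (by norm_num) (by norm_num)
    (x := (⟨0, 3, -1, -1⟩ : ℍ[ℚ,((-1 : ℤ) : ℚ),((3 : ℤ) : ℚ)])) (y := ⟨0, 3, 1, 1⟩) (e := ⟨0, 1, 0, 0⟩) rfl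
    (by rw [norm_three_i_add_j_add_ij]; norm_num) ⟨![0, 1, 0, 0], by ext <;> simp [ofCoords]⟩
    (by rw [QuaternionAlgebra.star_mk, QuaternionAlgebra.mk_mul_mk]; ext <;> norm_num)
    (by rw [QuaternionAlgebra.star_mk, QuaternionAlgebra.mk_mul_mk, QuaternionAlgebra.mk_mul_mk]; ext <;> norm_num)
    (im_sigma_coe_pos ⟨_, tauThree_im_pos⟩) tauThree_im_pos
    (moebius_rho_fixed_of_beta_conj (x := ⟨0, 3, 1, 1⟩)
      (by rw [QuaternionAlgebra.star_mk, QuaternionAlgebra.mk_mul_mk, QuaternionAlgebra.mk_mul_mk, QuaternionAlgebra.smul_mk]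
          ext <;> norm_num)
      ⟨_, tauThree_im_pos⟩ moebius_rho_tauThree)
    moebius_rho_tauThree

/-- **`(A(τ₃), ρ) ≇ (A(P₂), ρ)`: `P₄` and `P₂` are `Γ`-INEQUIVALENT** — the norm-`−1` unit `ε = 1 − i − ij` has
`ε(3i + j + ij)ε̄ = 3i − j + ij` (KRY's Lemma 3.4.3 mechanism, g29-#6: `P₂ = −P̄₄` is the mirror image of `P₄`).
[cite: KudlaRapoportYang2006, §3.4 Lemma 3.4.3 and §3.2 Prop. 3.2.1] [cite: BayerTravesa2007, §1 Thm. 1.1] -/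
theorem not_isRhoIsomorphic_tauThree_tauThreeBis :
    ¬ IsRhoIsomorphic (a := -1) (b := 3) (by norm_num) (by norm_num) tauThree_im_pos.ne' tauThreeBis_im_pos.ne' :=
  not_isRhoIsomorphic_of_conj_norm_neg_one
    (by exact_mod_cast Literature.RingTheory.CentralSimple.forall_isUnit_quaternionAlgebra_neg_one_three) (by norm_num)
    (by norm_num) (x := ⟨0, 3, 1, 1⟩) (y := ⟨0, 3, -1, 1⟩) (ε := ⟨1, -1, 0, -1⟩) rfl
    (by rw [norm_three_i_sub_j_add_ij]; norm_num) ⟨![1, -1, 0, -1], by ext <;> simp [ofCoords]⟩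
    (by rw [QuaternionAlgebra.star_mk, QuaternionAlgebra.mk_mul_mk]; ext <;> norm_num)
    (by rw [QuaternionAlgebra.star_mk, QuaternionAlgebra.mk_mul_mk, QuaternionAlgebra.mk_mul_mk]; ext <;> norm_num)
    tauThree_im_pos tauThreeBis_im_pos moebius_rho_tauThree moebius_rho_tauThreeBis

/-- **`P₂ ≢ P₄ (mod Γ₆)`: no `u ∈ O₆` of norm one maps `τ₃ = P₄` to `P₂`** — the two order-`3` elliptic points of `X₆` are
distinct; from Lang's curve: `Γ₆ = Γ ⊔ Γσ ⊔ Γσ²` (g30-#4), `στ₃ ≅_ρ τ₃`, and `τ₃ ≇_ρ P₂`.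
[cite: BayerTravesa2007, §1 Thm. 1.1 («`P₂, P₄` are elliptic of order `3`», two distinct vertices of the fundamental hexagon modulo the identifications (a)–(c))] [cite: KudlaRapoportYang2006, §3.2 Prop. 3.2.1] -/
theorem not_exists_maxOrder_unit_moebius_tauThree_eq_tauThreeBis :
    ¬ ∃ u : ℍ[ℚ,((-1 : ℤ) : ℚ),((3 : ℤ) : ℚ)], (u ∈ order (-1) 3 ∨ u - ⟨1/2, 1/2, 1/2, -1/2⟩ ∈ order (-1) 3) ∧
      u * star u = 1 ∧ moebius (rho (-1) 3 (by norm_num) (castQ (-1) 3 u)) (⟨(Real.sqrt 3 - 1) / 2, (Real.sqrt 3 - 1) / 2⟩ : ℂ) =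
        ⟨(1 - Real.sqrt 3) / 2, (Real.sqrt 3 - 1) / 2⟩ := by
  rintro ⟨u, hu, hu1, hmob⟩
  obtain ⟨v, hv, hv1, h⟩ := exists_order_unit_moebius_eq hu hu1
  rcases h with h | h | h
  · have h' := h ⟨_, tauThree_im_pos⟩
    simp only at h'
    rw [h'] at hmob
    exact not_isRhoIsomorphic_tauThree_tauThreeBis ((isRhoIsomorphic_iff_exists_unit_pm (a := -1) (b := 3)
      (by norm_num) (by norm_num) _ _).2 ⟨v, hv, Or.inl hv1, hmob⟩)
  · have h' := h ⟨_, tauThree_im_pos⟩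
    simp only at h'
    rw [h'] at hmob
    have hiso : IsRhoIsomorphic (a := -1) (b := 3) (by norm_num) (by norm_num)
        (im_sigma_coe_pos ⟨_, tauThree_im_pos⟩).ne' tauThreeBis_im_pos.ne' :=
      (isRhoIsomorphic_iff_exists_unit_pm (a := -1) (b := 3) (by norm_num) (by norm_num) _ _).2
        ⟨v, hv, Or.inl hv1, hmob⟩
    exact not_isRhoIsomorphic_tauThree_tauThreeBis (isRhoIsomorphic_sigma_tauThree_tauThree.symm.trans hiso)
  · have h' := h ⟨_, tauThree_im_pos⟩
    simp only at h'
    rw [h'] at hmob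
    have hiso : IsRhoIsomorphic (a := -1) (b := 3) (by norm_num) (by norm_num)
        (im_sigma_coe_pos ⟨_, im_sigma_coe_pos ⟨_, tauThree_im_pos⟩⟩).ne' tauThreeBis_im_pos.ne' :=
      (isRhoIsomorphic_iff_exists_unit_pm (a := -1) (b := 3) (by norm_num) (by norm_num) _ _).2
        ⟨v, hv, Or.inl hv1, hmob⟩
    have h2 : IsRhoIsomorphic (a := -1) (b := 3) (by norm_num) (by norm_num)
        (im_sigma_coe_pos ⟨_, im_sigma_coe_pos ⟨_, tauThree_im_pos⟩⟩).ne' tauThree_im_pos.ne' :=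
      (IsRhoIsomorphic.sigma _ _ isRhoIsomorphic_sigma_tauThree_tauThree).trans isRhoIsomorphic_sigma_tauThree_tauThree
    exact not_isRhoIsomorphic_tauThree_tauThreeBis (h2.symm.trans hiso)

/-- **SUMMARY — the two order-three elliptic points of `X₆` on Lang's curve: `P₄ = τ₃` and `P₂` are `Z(3)`-points with the
SAME abelian surface `ℂ/ℤ[ω] × ℂ/ℤ[√−3]`, fixed by the order-three elements `ρ(u₄) ∈ Γσ²`, `ρ(u₂) ∈ Γσ` of `Γ₆` which are
not in `ℝ^×Γ`, `Γ`-inequivalent and `Γ₆`-inequivalent.** [cite: BayerTravesa2007, §1 Thm. 1.1 and Table 1] [cite: KudlaRapoportYang2006, §3.4 (3.4.13)] -/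
theorem xSix_ellipticOrderThree_summary :
    moebius (rho (-1) 3 (by norm_num) (castQ (-1) 3 (⟨1/2, 3/2, 1/2, 1/2⟩ : ℍ[ℚ,((-1 : ℤ) : ℚ),((3 : ℤ) : ℚ)])))
        ⟨(Real.sqrt 3 - 1) / 2, (Real.sqrt 3 - 1) / 2⟩ = ⟨(Real.sqrt 3 - 1) / 2, (Real.sqrt 3 - 1) / 2⟩ ∧
    moebius (rho (-1) 3 (by norm_num) (castQ (-1) 3 (⟨1/2, 3/2, -1/2, 1/2⟩ : ℍ[ℚ,((-1 : ℤ) : ℚ),((3 : ℤ) : ℚ)])))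
        ⟨(1 - Real.sqrt 3) / 2, (Real.sqrt 3 - 1) / 2⟩ = ⟨(1 - Real.sqrt 3) / 2, (Real.sqrt 3 - 1) / 2⟩ ∧
    (∀ c : ℝ, ∀ ε ∈ order (-1) 3, (ε * star ε = 1 ∨ ε * star ε = -1) →
      rho (-1) 3 (by norm_num) (castQ (-1) 3 (⟨1/2, 3/2, 1/2, 1/2⟩ : ℍ[ℚ,((-1 : ℤ) : ℚ),((3 : ℤ) : ℚ)])) ≠
        c • rho (-1) 3 (by norm_num) (castQ (-1) 3 ε)) ∧
    ¬ IsRhoIsomorphic (a := -1) (b := 3) (by norm_num) (by norm_num) tauThree_im_pos.ne' tauThreeBis_im_pos.ne' ∧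
    IsIsomorphic (period (-1) 3 (by norm_num) (by norm_num) tauThreeBis_im_pos.ne')
      (period (-1) 3 (by norm_num) (by norm_num) tauThree_im_pos.ne') :=
  ⟨moebius_rho_uFour_tauThree, moebius_rho_uTwo_tauThreeBis, fun c _ hε hu ↦ rho_uFour_ne_smul_rho_unit c hε hu,
    not_isRhoIsomorphic_tauThree_tauThreeBis, isIsomorphic_period_tauThreeBis_prod_and.2⟩

end Classes

end Literature.Geometry.Kaehler.ComplexTorus.QuaternionType
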